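import Summits.QuantumFields.YangMills.Theorems.UnitScaleTiltProp7TiledCubeMemberH7H8PeeledA
import HarnessLib

/-!
# Route `UnitScaleTilt`, crux K1 «MinimiserStabilityRegPr» (stmt-QuantumFields-19200) — route-R E′ (A′), LANE II «DIVERGENCE RECOVERY AT CURVED `W`» (★★OWNER RULING №23),
# (B7) [I-5]∕[I-9] (a′) FILE 6b — **`h7 ⊕ h8` AT THE MEMBER, PEELED FORM: STAGE B AND THE ROW OF RECORD** (★p1 g19 NAMER WORD №16, 2026-08-29 12:46Z, adopting w1-19200 g16's (P2) «PEEL, DON'T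
# RE-ANCHOR»): the rows of ⧗p717841 `h7h8_member_in` with every `Ω`-sum — the box mass on the left, the coarse `Ū`-difference sum `Gc`, the px5 conversion costs —
# taken over an INNER CONCENTRIC TILED BOX `Ω_f = box z R_in` (`R_in + p·ℓ = R_f`, blocks `lo′ + [0, m′]³`, record `p = 4`, `lo′ = lo + 4`, `m′ = m − 8`), while
# the anchor (0) `Σ_{box z R_f} Ad(u w)φ_Z(w) = 0`, the chart-function row `hφZ`, the plaquette hypothesis `hP` and the inside chart energy `Gφ_in` stay on the FULL
# chart box `box z R_f` EXACTLY as ⧗`patch_alpha_member` exports them ((0), (S1b), (P-box), (h1)) — nothing new is asked of (B8).  The mean of `Ad(u)φ_Z` over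
# `Ω_f` no longer vanishes; it is paid by ✓px4 `Prop7LatticeTiledCube.norm_sum_axial_sq_le_of_normalised (t := p·ℓ)` from (0) on the full box, giving ONE extra
# displayed term `8·(#(box∖Ω_f)∕#Ω_f)·[(4dt∕(2R_f+1) + 32dt(2R_f+1)(2dR_fα)²)·‖φ‖² + 8t(2R_f+1)·η²·Gφ_in]` (K-uniform: `#(box∖Ω_f)∕#Ω_f = O(R₀⁻¹)`, `t∕(2R_f+1) = O(R₀⁻¹)`,
# `t(2R_f+1)η² = O(R₀)·(ηℓ)² = O(R₀)`).  WHY PEEL: w1 g16's witness (bus 12:35:39Z) — h9 is FALSE for `Gc` over ALL coarse bonds of the chart box (the bottom∕top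
# block layers' read sets leave the local-equation region); on the peeled bonds (both endpoints in `Ω_f`) ✓p715415 `coarseGrad_rows_on_inner` applies with w1's
# box-plateau cutoff `χ`.

Cell `ym3-torus` ∕ width seat `ym3-torus-px9` (gen 8, «width 9»).  THEOREMS ONLY (0 `def`, 0 `sorry`); `--supports stmt-QuantumFields-19200 --as helper`, count-neutral.
YM₃ on T³ is a ladder rung (R3), not d = 4, not the Clay problem; nothing here claims (B7), (REC), `hN06`, E′, EX or the gap.

WHAT IS PROVED (ns `…Theorems.Prop7TiledCubeMemberH7H8Peeled`): ★★★ `h7h8_core_peeled` (ℤ³ coarse letters) · ★★★ `h7h8_member_peeled` (torus letters: the coarse term over the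
image set `ι(C(lo′, m′))` of the inner cube's coarse bonds — the `S` of h9).  Stage A (`knitA_peeled`) and `peeled_tiled` are FILE 6a `…TiledCubeMemberH7H8PeeledA`.
HONEST SCOPE.  Bookkeeping over landed rows ((B9d), px4 §6, px5 [I-5-conv], FILES 1–5); nothing of (B7)∕(REC)∕`hN06`∕the crux is asserted; rung R3, not Clay; YM gap NOT proved.

References: T. Bałaban, CMP 98 (1985) 17–51 [Balaban1985Averaging] ((20) p.21, pp.24–25: blockwise Poincaré with the mean term); T. Bałaban, CMP 99 (1985) 389–434
[Balaban1985BackgroundPropagators] ((3.19) p.393, (3.100) p.413: localisation with collars); T. Bałaban, CMP 99 (1985) 75–102 [Balaban1985RegularSpaces] ((1.3) p.77).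
-/

set_option autoImplicit false

open scoped BigOperators Matrix.Norms.L2Operator

namespace Summit.QuantumFields.YangMills.Theorems.Prop7TiledCubeMemberH7H8Peeled

open Literature.MathematicalPhysics.QuantumFieldTheory.Balaban1983to89
open Literature.MathematicalPhysics.QuantumFieldTheory.Balaban1983to89.T3ContinuumYM3Torus
open Literature.MathematicalPhysics.QuantumFieldTheory.Balaban1983to89.T3PrintedRegularMinimiser (RegPr)
open Literature.MathematicalPhysics.QuantumFieldTheory.Balaban1983to89.B4Eq19LatticeOperators (Zd box unitVec mem_box box_mono)
open Literature.MathematicalPhysics.QuantumLattice (blockMap blockBase blockSites)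
open B10Eq27TorusAxialLog (transl pull pull_apply holT unitsField toUField)
open B7Prop1Explicit (axialFn U1 e)
open B7Prop2Explicit (C0 c2')
open B7Eq78Linearization (conjR QprimeIter zdBlocking)
open B8Eq119TwistedAxial (bgT)
open B9B8AveragingKernelZd (blockIter)
open T4TermwiseTorus (tlift)
open T3SectALandauChart (eta eta_pos bgUnits)
open B11Eq103H1Complex (SiteL2K BondL2K)
open Summit.QuantumFields.YangMills.Theorems.Prop7SectET3Transport (periodsT3)
open Summit.QuantumFields.YangMills.Theorems.Prop7SectET3HilbertLetters (W₂ toL2 toL2S DL2)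
open Summit.QuantumFields.YangMills.Theorems.Prop7SPrint (basePt)
open Summit.QuantumFields.YangMills.Theorems.Prop7QprimeCombL2 (QprimeCombL2)
open Summit.QuantumFields.YangMills.Theorems.Prop7LatticeTiledCube (sum_tiled_sq_le_plaq norm_sum_axial_sq_le_of_normalised card_tiled)
open Summit.QuantumFields.YangMills.Theorems.Prop7TiledCubeMemberRows (chart_mass_le eta_sq_sum_opNorm_sq_le_norm_sq)
open Summit.QuantumFields.YangMills.Theorems.Prop7CombVsAxialMeansMember (sum_sq_grad_conv_of_regPr)
open Summit.QuantumFields.YangMills.Theorems.Prop7TiledCubeMemberKnit (blockIter_eq_blk tiled_eq_box_of succ_le_sitesPerDir_of knitB_arith weight_eq)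
open Summit.QuantumFields.YangMills.Theorems.Prop7TiledCubeMemberH7H8 (sum_normSq_axialDiff_eq sum_C_src_le sum_C_tgt_le sum_C_normSq_combDiff_eq)
open Summit.QuantumFields.YangMills.Theorems.Prop7TiledCubeMemberH7H8PeeledA (knitA_peeled)

variable (F : T3Family) (n K : ℕ) (c₀ : ℝ) [Fact (0 < c₀)]

/-! ## §3 Stage B on the inner box -/

/-- ★★★ **(a′) STAGE B, PEELED — `h7 ⊕ h8` AT THE MEMBER ON THE INNER BOX, `ℤ³` COARSE LETTERS**: the blockwise Poincaré bound of the INNER box mass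
`c₀Σ_{w ∈ box z R_in}hs(φ♭(basePt + w))` (`R_in + p·ℓ = R_f`, inner blocks `lo′ + [0, m′]³`) with the anchor (0), `hφZ`, `hP`, `Gφ_in` on the FULL chart box
`box z R_f`, the coarse term converted to the `Ū`-differences of the comb averages on the inner cube's coarse bonds (px5's [I-5-conv] at height `M = m′ + 1 + p`
above the axial base `z − R_f`) plus `e²`-costs, and the peeled mean term. [cite: Balaban1985Averaging, pp.24-25; Balaban1985BackgroundPropagators, (3.100) p.413] -/
theorem h7h8_core_peeled {L : ℕ} (hL : 1 < L) (hF : F.L = L) (hnK : n ≤ K) {ε : ℝ} (he : 0 < ε) (he4 : ε ≤ min (6 * C0 3)⁻¹ (c2' 3 L / 4))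
    (W : GaugeField (F.P K) 0 (Matrix.specialUnitaryGroup (Fin 2) ℂ)) (hW : RegPr F n K ε W)
    {CT : ℝ} (T : PBond (F.P K) (K - n) → (Matrix (Fin 2) (Fin 2) ℂ)ˣ) (hTU1 : ∀ c, T c ∈ U1 (Matrix (Fin 2) (Fin 2) ℂ))
    (hclose : ∀ c : PBond (F.P K) (K - n),
      ‖(T c : Matrix (Fin 2) (Fin 2) ℂ) - ((holT (unitsField (toUField W)) (transl (basePt F n K) (blockBase ((F.P K).L ^ (K - n)) (tlift c.src)))
          (List.replicate ((F.P K).L ^ (K - n)) (c.dir, true)) : (Matrix (Fin 2) (Fin 2) ℂ)ˣ) : Matrix (Fin 2) (Fin 2) ℂ)‖ ≤ CT * ε)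
    {z : Zd (F.P K).d} {Rf Rin : ℤ} (hRf0 : 0 ≤ Rf) (hRN : 2 * Rf + 1 ≤ ((F.P K).sitesPerDir 0 : ℤ))
    (p : ℕ) (hRin : Rin + ((p * F.L ^ (K - n) : ℕ) : ℤ) = Rf) (lo' : Zd (F.P K).d) (m' : ℕ)
    (hzlo' : ∀ i, z i - Rin = ((F.L ^ (K - n) : ℕ) : ℤ) * lo' i)
    (hzhi' : ∀ i, z i + Rin = ((F.L ^ (K - n) : ℕ) : ℤ) * lo' i + (((m' + 1) * F.L ^ (K - n) - 1 : ℕ) : ℤ))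
    (V : Zd (F.P K).d → Fin (F.P K).d → (Matrix (Fin 2) (Fin 2) ℂ)ˣ) (hV : ∀ w μ, V w μ = unitsField (toUField W) ⟨transl (basePt F n K) w, μ⟩)
    {α : ℝ} (hα : 0 ≤ α) (hP : B8Lemma1NonAbelian.PlaqSmall V (fun i => z i - Rf) (fun i => z i + Rf) α)
    (φ : SiteL2K ℂ 3 (periodsT3 F K) c₀ W₂) (φZ : Zd (F.P K).d → Matrix (Fin 2) (Fin 2) ℂ)
    (hφZ : ∀ w ∈ box z Rf, (toL2S F K c₀).symm φ (transl (basePt F n K) w) = (eta F n K) • φZ w)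
    (h0 : ∑ w ∈ box z Rf, conjR (axialFn V (fun i => z i - Rf) w) (φZ w) = 0) :
    c₀ * ∑ w ∈ box z Rin, ∑ j : Fin 2, ∑ k : Fin 2, ‖((toL2S F K c₀).symm φ (transl (basePt F n K) w)) j k‖ ^ 2
      ≤ 8 * (c₀ * ∑ w ∈ box z Rf, ∑ μ, (if w + unitVec μ ∈ box z Rf then
            ∑ j : Fin 2, ∑ k : Fin 2, ‖(conjR (V w μ) (φZ (w + unitVec μ)) - φZ w) j k‖ ^ 2 else 0))
        + (32 * ((F.L : ℝ) ^ (K - n)) ^ 2 * (2 * ((F.P K).d : ℝ) * Rf * α) ^ 2 * ((F.P K).d : ℝ) * ‖φ‖ ^ 2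
          + 8 * (((box z Rf \ box z Rin).card : ℝ) * ((box z Rin).card : ℝ)⁻¹) *
            ((4 * ((F.P K).d : ℝ) * ((p * F.L ^ (K - n) : ℕ) : ℝ) / (2 * (Rf : ℝ) + 1)
                + 32 * ((F.P K).d : ℝ) * ((p * F.L ^ (K - n) : ℕ) : ℝ) * (2 * (Rf : ℝ) + 1) * (2 * ((F.P K).d : ℝ) * Rf * α) ^ 2) * ‖φ‖ ^ 2
              + 8 * ((p * F.L ^ (K - n) : ℕ) : ℝ) * (2 * (Rf : ℝ) + 1) * ((eta F n K) ^ 2 *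
                (c₀ * ∑ w ∈ box z Rf, ∑ μ, (if w + unitVec μ ∈ box z Rf then
                  ∑ j : Fin 2, ∑ k : Fin 2, ‖(conjR (V w μ) (φZ (w + unitVec μ)) - φZ w) j k‖ ^ 2 else 0)))))
        + 32 * ((m' : ℝ) * (m' + 1) / 2) *
            (c₀ * ((((F.L ^ (K - n)) ^ (F.P K).d : ℕ) : ℝ)) *
              ∑ q ∈ ((Fintype.piFinset (fun i => Finset.Icc (lo' i) (lo' i + m'))) ×ˢ (Finset.univ : Finset (Fin (F.P K).d))).filter
                  (fun q => q.1 + e q.2 ∈ Fintype.piFinset (fun i => Finset.Icc (lo' i) (lo' i + m'))),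
                ‖conjR (pull T 0 q.1 q.2)
                    (QprimeIter (zdBlocking (F.P K).d (F.P K).L) (bgT (F.P K).L (pull (bgUnits F K W) (basePt F n K))) (K - n)
                      (fun x => (toL2S F K c₀).symm φ (transl (basePt F n K) x)) (q.1 + e q.2))
                  - QprimeIter (zdBlocking (F.P K).d (F.P K).L) (bgT (F.P K).L (pull (bgUnits F K W) (basePt F n K))) (K - n)
                      (fun x => (toL2S F K c₀).symm φ (transl (basePt F n K) x)) q.1‖ ^ 2)
        + 64 * ((m' : ℝ) * (m' + 1) / 2) * ((F.P K).d : ℝ) *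
            (((2 * CT + 48 * ((m' + 1 + p : ℕ) : ℝ) + 29232) * ε) ^ 2 + ((29232 + 36 * ((m' + 1 + p : ℕ) : ℝ)) * ε) ^ 2) * ‖φ‖ ^ 2 := by
  classical
  have hc : 0 < c₀ := Fact.out
  have hL0 : 0 < F.L := by have := F.hL.2; omega
  have hℓ : 1 ≤ F.L ^ (K - n) := Nat.one_le_pow _ _ hL0
  have hη : 0 < eta F n K := eta_pos F n K
  have hp0 : (0 : ℤ) ≤ ((p * F.L ^ (K - n) : ℕ) : ℤ) := Int.natCast_nonneg _
  have hRin_le : Rin ≤ Rf := by omega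
  have hsubB : box z Rin ⊆ box z Rf := box_mono z hRin_le
  have hRNin : 2 * Rin + 1 ≤ ((F.P K).sitesPerDir 0 : ℤ) := by omega
  -- the pull-back connection IS `pull (bgUnits W) basePt`
  have hVeq : V = pull (bgUnits F K W) (basePt F n K) := funext fun w => funext fun μ => hV w μ
  subst hVeq
  have hbox := tiled_eq_box_of F n K lo' m' hzlo' hzhi'
  have hφZin : ∀ w ∈ box z Rin, (toL2S F K c₀).symm φ (transl (basePt F n K) w) = (eta F n K) • φZ w := fun w hw => hφZ w (hsubB hw)
  -- stage A
  have hA := knitA_peeled F n K c₀ W (basePt F n K) hRf0 hRN (p * F.L ^ (K - n)) hRin lo' m' hbox _ (fun w μ => rfl) hα hP φ φZ hφZ h0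
  -- the currency identity and the conversion row (px5), axial base `z − R_f`, height `M = m′ + 1 + p`
  have hY := sum_normSq_axialDiff_eq F n K c₀ (pull (bgUnits F K W) (basePt F n K)) (fun i => z i - Rf) lo' m' hzlo' hzhi' φ φZ hφZin
  have hC' : ∀ q ∈ ((Fintype.piFinset (fun i => Finset.Icc (lo' i) (lo' i + m'))) ×ˢ (Finset.univ : Finset (Fin (F.P K).d))).filter
        (fun q => q.1 + e q.2 ∈ Fintype.piFinset (fun i => Finset.Icc (lo' i) (lo' i + m'))),
      (fun i => z i - Rf) ≤ blockBase ((F.P K).L ^ (K - n)) q.1 ∧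
      (∀ x ∈ blockIter (F.P K).L (K - n) q.1, ∀ i, x i - (fun i => z i - Rf) i ≤ (((m' + 1 + p) * (F.P K).L ^ (K - n) : ℕ) : ℤ)) ∧
      (∀ x ∈ blockIter (F.P K).L (K - n) (q.1 + e q.2), ∀ i, x i - (fun i => z i - Rf) i ≤ (((m' + 1 + p) * (F.P K).L ^ (K - n) : ℕ) : ℤ)) := by
    intro q hq
    rw [Finset.mem_filter, Finset.mem_product] at hq
    obtain ⟨⟨hq1, -⟩, hq2⟩ := hq
    have hℓ0 : (0 : ℤ) ≤ ((F.L ^ (K - n) : ℕ) : ℤ) := by positivity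
    have hcast : (((m' + 1 + p) * (F.P K).L ^ (K - n) : ℕ) : ℤ) = ((m' : ℤ) + 1 + p) * ((F.L ^ (K - n) : ℕ) : ℤ) := by
      rw [show (F.P K).L = F.L from rfl]; push_cast; ring
    have hcast1 : ((F.L ^ (K - n) - 1 : ℕ) : ℤ) = ((F.L ^ (K - n) : ℕ) : ℤ) - 1 := by rw [Nat.cast_sub hℓ]; simp
    have hcastp : ((p * F.L ^ (K - n) : ℕ) : ℤ) = (p : ℤ) * ((F.L ^ (K - n) : ℕ) : ℤ) := by push_cast; ring
    have hzRf : ∀ i, z i - Rf = ((F.L ^ (K - n) : ℕ) : ℤ) * lo' i - (p : ℤ) * ((F.L ^ (K - n) : ℕ) : ℤ) := fun i => by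
      have h := hzlo' i
      rw [hcastp] at hRin
      linear_combination h + hRin
    have height : ∀ b ∈ Fintype.piFinset (fun i => Finset.Icc (lo' i) (lo' i + m')),
        ∀ x ∈ blockIter (F.P K).L (K - n) b, ∀ i, x i - (fun i => z i - Rf) i ≤ (((m' + 1 + p) * (F.P K).L ^ (K - n) : ℕ) : ℤ) := by
      intro b hb x hx i
      rw [blockIter_eq_blk] at hx
      have h1 := (Finset.mem_Icc.mp (Fintype.mem_piFinset.mp hx i)).2
      have h2 := (Finset.mem_Icc.mp (Fintype.mem_piFinset.mp hb i)).2
      have h3 : ((F.L ^ (K - n) : ℕ) : ℤ) * b i ≤ ((F.L ^ (K - n) : ℕ) : ℤ) * (lo' i + m') := mul_le_mul_of_nonneg_left h2 hℓ0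
      show x i - (z i - Rf) ≤ _
      rw [hzRf i, hcast]
      rw [hcast1] at h1
      have hp' : (0 : ℤ) ≤ (p : ℤ) := Int.natCast_nonneg p
      nlinarith
    refine ⟨fun i => ?_, height q.1 hq1, height (q.1 + e q.2) hq2⟩
    show z i - Rf ≤ (((F.P K).L ^ (K - n) : ℕ) : ℤ) * q.1 i
    rw [hzRf i, show (F.P K).L = F.L from rfl]
    have hp' : (0 : ℤ) ≤ (p : ℤ) := Int.natCast_nonneg p
    have h4 : ((F.L ^ (K - n) : ℕ) : ℤ) * lo' i ≤ ((F.L ^ (K - n) : ℕ) : ℤ) * q.1 i :=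
      mul_le_mul_of_nonneg_left (Finset.mem_Icc.mp (Fintype.mem_piFinset.mp hq1 i)).1 hℓ0
    nlinarith
  have hconv := (sum_sq_grad_conv_of_regPr F n K hL hF hnK he he4 hW T hTU1 hclose (fun i => z i - Rf) (m' + 1 + p) _ hC'
    (fun x => (toL2S F K c₀).symm φ (transl (basePt F n K) x))).2
  have hS1 := sum_C_tgt_le F n K c₀ lo' m' hzlo' hzhi' φ φZ hφZin
  have hS2 := sum_C_src_le F n K c₀ lo' m' hzlo' hzhi' φ φZ hφZin
  have hCrow := eta_sq_sum_opNorm_sq_le_norm_sq F n K c₀ (basePt F n K) hRN φ φZ hφZ (box z Rin) hsubB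
  have hω := weight_eq F n K
  have hℓd : (0 : ℝ) < ((((F.L ^ (K - n)) ^ (F.P K).d : ℕ) : ℝ)) := by positivity
  have hd0 : (0 : ℝ) ≤ ((F.P K).d : ℝ) := Nat.cast_nonneg _
  have hcm : (0 : ℝ) ≤ (m' : ℝ) * (m' + 1) / 2 := by positivity
  exact knitB_arith hc.le hcm hℓd hd0 hA hY hω hconv hS1 hS2 hCrow

/-- ★★★ **(a′) `h7 ⊕ h8` AT THE MEMBER, PEELED FORM (THE ROW OF RECORD after NAMER WORD №16)** — as ⧗`h7h8_member_in` but on the INNER box `box z R_in` of the base chart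
`basePt` (`R_in + p·ℓ = R_f`, tiled by the `(m′+1)^3` comb blocks `b ∈ lo′ + [0,m′]^3`: `z − R_in = ℓ·lo′`, `z + R_in = ℓ·lo′ + (m′+1)ℓ − 1`; record `p = 4`, `lo′ = lo + 4`,
`m′ = 4R₀ − 6` via `peeled_tiled`), with the local potential's rows on the FULL chart box `box z R_f` exactly as ⧗`patch_alpha_member` exports them: chart function `φ_Z`
(`hφZ` = (S1b)), anchor (0) (`h0`), the box pull-back `V` with `PlaqSmall V (z−R_f) (z+R_f) α` ((P-box)), and any unit coarse transporter `T` with the (B3c) rider: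
`Φt_in ≤ 8·Gφ_in + 32ℓ²(2dR_fα)²d·‖φ‖² + 8·(#(box z R_f ∖ box z R_in)∕#(box z R_in))·[(4dt∕(2R_f+1) + 32dt(2R_f+1)(2dR_fα)²)·‖φ‖² + 8t(2R_f+1)·η²·Gφ_in]
 + 32·c_{m′}·(c₀ℓ^d·Σ_{ĉ ∈ ι(C′)}‖Ad(T ĉ)(Q′φ)(ĉ₊) − (Q′φ)(ĉ.src)‖²) + 64·c_{m′}·d·(γ′² + γ²)·‖φ‖²`,
`Φt_in := c₀Σ_{w ∈ box z R_in}hs(φ♭(basePt + w))`, `Gφ_in := c₀Σ_{w∈box z R_f}Σ_μ𝟙[w+e_μ∈box z R_f]·hs(Ad(V w μ)φ_Z(w+e_μ) − φ_Z w)` ((h1)'s letter), `t = p·ℓ`,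
`c_{m′} = m′(m′+1)∕2`, `γ′ = (2CT + 48(m′+1+p) + 29232)ε`, `γ = (29232 + 36(m′+1+p))ε`, `Q′φ := QprimeCombL2 W φ`, `ι(C′)` = the torus images `⟨transl 0 b, μ⟩` of the
coarse bonds with BOTH endpoints in the inner cube — the `S` of ✓p715415 `coarseGrad_rows_on_inner` (w1 g16's χ-plateau covers their read sets for `p = 4`).
[cite: Balaban1985Averaging, pp.24-25; Balaban1985BackgroundPropagators, (3.19) p.393, (3.100) p.413] -/
theorem h7h8_member_peeled {L : ℕ} (hL : 1 < L) (hF : F.L = L) (hnK : n ≤ K) {ε : ℝ} (he : 0 < ε) (he4 : ε ≤ min (6 * C0 3)⁻¹ (c2' 3 L / 4))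
    (W : GaugeField (F.P K) 0 (Matrix.specialUnitaryGroup (Fin 2) ℂ)) (hW : RegPr F n K ε W)
    {CT : ℝ} (T : PBond (F.P K) (K - n) → (Matrix (Fin 2) (Fin 2) ℂ)ˣ) (hTU1 : ∀ c, T c ∈ U1 (Matrix (Fin 2) (Fin 2) ℂ))
    (hclose : ∀ c : PBond (F.P K) (K - n),
      ‖(T c : Matrix (Fin 2) (Fin 2) ℂ) - ((holT (unitsField (toUField W)) (transl (basePt F n K) (blockBase ((F.P K).L ^ (K - n)) (tlift c.src)))
          (List.replicate ((F.P K).L ^ (K - n)) (c.dir, true)) : (Matrix (Fin 2) (Fin 2) ℂ)ˣ) : Matrix (Fin 2) (Fin 2) ℂ)‖ ≤ CT * ε)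
    {z : Zd (F.P K).d} {Rf Rin : ℤ} (hRf0 : 0 ≤ Rf) (hRN : 2 * Rf + 1 ≤ ((F.P K).sitesPerDir 0 : ℤ))
    (p : ℕ) (hRin : Rin + ((p * F.L ^ (K - n) : ℕ) : ℤ) = Rf) (lo' : Zd (F.P K).d) (m' : ℕ)
    (hzlo' : ∀ i, z i - Rin = ((F.L ^ (K - n) : ℕ) : ℤ) * lo' i)
    (hzhi' : ∀ i, z i + Rin = ((F.L ^ (K - n) : ℕ) : ℤ) * lo' i + (((m' + 1) * F.L ^ (K - n) - 1 : ℕ) : ℤ))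
    (V : Zd (F.P K).d → Fin (F.P K).d → (Matrix (Fin 2) (Fin 2) ℂ)ˣ) (hV : ∀ w μ, V w μ = unitsField (toUField W) ⟨transl (basePt F n K) w, μ⟩)
    {α : ℝ} (hα : 0 ≤ α) (hP : B8Lemma1NonAbelian.PlaqSmall V (fun i => z i - Rf) (fun i => z i + Rf) α)
    (φ : SiteL2K ℂ 3 (periodsT3 F K) c₀ W₂) (φZ : Zd (F.P K).d → Matrix (Fin 2) (Fin 2) ℂ)
    (hφZ : ∀ w ∈ box z Rf, (toL2S F K c₀).symm φ (transl (basePt F n K) w) = (eta F n K) • φZ w)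
    (h0 : ∑ w ∈ box z Rf, conjR (axialFn V (fun i => z i - Rf) w) (φZ w) = 0) :
    c₀ * ∑ w ∈ box z Rin, ∑ j : Fin 2, ∑ k : Fin 2, ‖((toL2S F K c₀).symm φ (transl (basePt F n K) w)) j k‖ ^ 2
      ≤ 8 * (c₀ * ∑ w ∈ box z Rf, ∑ μ, (if w + unitVec μ ∈ box z Rf then
            ∑ j : Fin 2, ∑ k : Fin 2, ‖(conjR (V w μ) (φZ (w + unitVec μ)) - φZ w) j k‖ ^ 2 else 0))
        + (32 * ((F.L : ℝ) ^ (K - n)) ^ 2 * (2 * ((F.P K).d : ℝ) * Rf * α) ^ 2 * ((F.P K).d : ℝ) * ‖φ‖ ^ 2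
          + 8 * (((box z Rf \ box z Rin).card : ℝ) * ((box z Rin).card : ℝ)⁻¹) *
            ((4 * ((F.P K).d : ℝ) * ((p * F.L ^ (K - n) : ℕ) : ℝ) / (2 * (Rf : ℝ) + 1)
                + 32 * ((F.P K).d : ℝ) * ((p * F.L ^ (K - n) : ℕ) : ℝ) * (2 * (Rf : ℝ) + 1) * (2 * ((F.P K).d : ℝ) * Rf * α) ^ 2) * ‖φ‖ ^ 2
              + 8 * ((p * F.L ^ (K - n) : ℕ) : ℝ) * (2 * (Rf : ℝ) + 1) * ((eta F n K) ^ 2 *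
                (c₀ * ∑ w ∈ box z Rf, ∑ μ, (if w + unitVec μ ∈ box z Rf then
                  ∑ j : Fin 2, ∑ k : Fin 2, ‖(conjR (V w μ) (φZ (w + unitVec μ)) - φZ w) j k‖ ^ 2 else 0)))))
        + 32 * ((m' : ℝ) * (m' + 1) / 2) *
            (c₀ * ((((F.L ^ (K - n)) ^ (F.P K).d : ℕ) : ℝ)) *
              ∑ ĉ ∈ (((Fintype.piFinset (fun i => Finset.Icc (lo' i) (lo' i + m'))) ×ˢ (Finset.univ : Finset (Fin (F.P K).d))).filter
                  (fun q => q.1 + e q.2 ∈ Fintype.piFinset (fun i => Finset.Icc (lo' i) (lo' i + m')))).image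
                  (fun q => (⟨transl (0 : Site (F.P K) (K - n)) q.1, q.2⟩ : PBond (F.P K) (K - n))),
                ‖conjR (T ĉ) (QprimeCombL2 F n K c₀ W φ (ĉ.src.shift ĉ.dir)) - QprimeCombL2 F n K c₀ W φ ĉ.src‖ ^ 2)
        + 64 * ((m' : ℝ) * (m' + 1) / 2) * ((F.P K).d : ℝ) *
            (((2 * CT + 48 * ((m' + 1 + p : ℕ) : ℝ) + 29232) * ε) ^ 2 + ((29232 + 36 * ((m' + 1 + p : ℕ) : ℝ)) * ε) ^ 2) * ‖φ‖ ^ 2 := by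
  have hd : 0 < (F.P K).d := by rw [T3Family.P_d]; norm_num
  have hp0 : (0 : ℤ) ≤ ((p * F.L ^ (K - n) : ℕ) : ℤ) := Int.natCast_nonneg _
  have hRNin : 2 * Rin + 1 ≤ ((F.P K).sitesPerDir 0 : ℤ) := by omega
  have hm := succ_le_sitesPerDir_of F n K hnK hRNin lo' m' ⟨0, hd⟩ (hzlo' _) (hzhi' _)
  rw [← sum_C_normSq_combDiff_eq F n K c₀ hnK W T lo' m' hm φ]
  exact h7h8_core_peeled F n K c₀ hL hF hnK he he4 W hW T hTU1 hclose hRf0 hRN p hRin lo' m' hzlo' hzhi' V hV hα hP φ φZ hφZ h0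

end Summit.QuantumFields.YangMills.Theorems.Prop7TiledCubeMemberH7H8Peeled
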